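import Literature.NumberTheory.EllipticCurves.ShintaniMoebiusTransport
import HarnessLib

/-!
# Stabilisers of indefinite forms, I: diagonal stabilisers of `λ XY` and the multiplier

[[cite: Shintani1975, §2, proof of Prop. 2.3 (p. 104)]] — after conjugating an indefinite form `x`
to `λ XY` by `M ∈ SL₂(ℝ)` (`ShintaniMoebiusTransport`), its stabiliser becomes the diagonal group
and acts on `ℍ` by homotheties.  We PROVE:

* `actSL g x = x ∘ g` for `g ∈ SL₂(ℝ)` (a right action, `= actM` on `SL₂(ℤ)`);
* **`actSL_xyForm_eq_iff`** — `(λXY) ∘ g = λXY ↔ g` is diagonal (`λ ≠ 0`);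
* **`actSL_eq_iff_conj`** — with `x ∘ M = λXY`: `x ∘ g = x ↔ M⁻¹ g M` is diagonal;
* `multK M g = u²` for `M⁻¹ g M = diag(u, u⁻¹)`: `multK_pos`, **`multK_mul`** (a homomorphism on
  the stabiliser), **`coe_inv_smul_smul`** (`M⁻¹(g w) = κ(g) · M⁻¹ w`), and
  `eq_one_or_neg_one_of_multK_eq_one` (`κ(g) = 1 ⇒ g = ±1`).

No named facts; the definitions are `actSL` and `multK`.
-/

noncomputable section

open scoped MatrixGroups ModularForm Modular Topology
open UpperHalfPlane hiding I
open Complex Filter MeasureTheory Set CongruenceSubgroup ModularGroup Real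
open Literature.NumberTheory.EllipticCurves.ModularForms

namespace Literature.NumberTheory.EllipticCurves.Shintani

/-! ### The right action of `SL₂(ℝ)` on forms -/

/-- `x ∘ g` for `g ∈ SL₂(ℝ)`. [folklore] -/
def actSL (g : SL(2, ℝ)) (x : V) : V := actV (g 0 0) (g 0 1) (g 1 0) (g 1 1) x

/-- `actSL` is a right action. [folklore] -/
theorem actSL_mul (g h : SL(2, ℝ)) (x : V) : actSL h (actSL g x) = actSL (g * h) x := by
  unfold actSL
  rw [actV_actV]
  have e : ∀ i j, ((g * h) i j : ℝ) = g i 0 * h 0 j + g i 1 * h 1 j := by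
    intro i j; simp [Matrix.mul_apply, Fin.sum_univ_two]
  rw [e 0 0, e 0 1, e 1 0, e 1 1]

/-- `actSL 1 = id`. [folklore] -/
theorem actSL_one (x : V) : actSL 1 x = x := by
  unfold actSL; simpa using actV_id x

/-- On integer matrices `actSL` is `actM`. [folklore] -/
theorem actSL_coe (γ : SL(2, ℤ)) (x : V) : actSL (γ : SL(2, ℝ)) x = actM γ x := by
  rfl

/-- `(λXY) ∘ g = λ (ac, ad + bc, bd)`. [folklore] -/
theorem actSL_xyForm (g : SL(2, ℝ)) (lam : ℝ) :
    actSL g (xyForm lam) = !₂[lam * g 0 0 * g 1 0, lam * (g 0 0 * g 1 1 + g 0 1 * g 1 0), lam * g 0 1 * g 1 1] := by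
  unfold actSL
  ext i
  fin_cases i <;> simp [actV, xyForm]

/-- `a d - b c = 1` for `g ∈ SL₂(ℝ)` (entries). [folklore] -/
theorem det_entries_real (g : SL(2, ℝ)) : (g 0 0 : ℝ) * g 1 1 - g 0 1 * g 1 0 = 1 := by
  have := Matrix.det_fin_two (g : Matrix (Fin 2) (Fin 2) ℝ)
  rw [g.det_coe] at this
  linarith

/-- **The stabiliser of `λXY` in `SL₂(ℝ)` consists of the diagonal matrices.** [folklore] -/
theorem actSL_xyForm_eq_iff {lam : ℝ} (hlam : lam ≠ 0) (g : SL(2, ℝ)) :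
    actSL g (xyForm lam) = xyForm lam ↔ (g 1 0 : ℝ) = 0 ∧ (g 0 1 : ℝ) = 0 := by
  have hdet := det_entries_real g
  rw [actSL_xyForm]
  constructor
  · intro h
    have h0 := congrFun (congrArg (fun v : V ↦ (v : Fin 3 → ℝ)) h) 0
    have h1 := congrFun (congrArg (fun v : V ↦ (v : Fin 3 → ℝ)) h) 1
    have h2 := congrFun (congrArg (fun v : V ↦ (v : Fin 3 → ℝ)) h) 2
    simp [xyForm] at h0 h1 h2
    have hac : (g 0 0 : ℝ) * g 1 0 = 0 := by
      rcases h0 with h0 | h0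
      · rcases h0 with h0 | h0
        · exact absurd h0 hlam
        · rw [h0, zero_mul]
      · rw [h0, mul_zero]
    have hbd : (g 0 1 : ℝ) * g 1 1 = 0 := by
      rcases h2 with h2 | h2
      · rcases h2 with h2 | h2
        · exact absurd h2 hlam
        · rw [h2, zero_mul]
      · rw [h2, mul_zero]
    have hsum : (g 0 0 : ℝ) * g 1 1 + g 0 1 * g 1 0 = 1 := by
      have : lam * ((g 0 0 : ℝ) * g 1 1 + g 0 1 * g 1 0) = lam * 1 := by rw [mul_one]; exact h1
      exact mul_left_cancel₀ hlam this
    have had : (g 0 0 : ℝ) * g 1 1 = 1 := by linarith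
    have ha0 : (g 0 0 : ℝ) ≠ 0 := by intro h; rw [h, zero_mul] at had; exact zero_ne_one had
    have hd0 : (g 1 1 : ℝ) ≠ 0 := by intro h; rw [h, mul_zero] at had; exact zero_ne_one had
    refine ⟨?_, ?_⟩
    · rcases mul_eq_zero.mp hac with h | h
      · exact absurd h ha0
      · exact h
    · rcases mul_eq_zero.mp hbd with h | h
      · exact h
      · exact absurd h hd0
  · rintro ⟨hc, hb⟩
    have had : (g 0 0 : ℝ) * g 1 1 = 1 := by rw [hb, zero_mul, sub_zero] at hdet; exact hdet
    ext i
    fin_cases i <;> simp [xyForm, hc, hb, had]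

/-! ### Conjugating the stabiliser to the diagonal group -/

section Conj

variable {x : V} {M : SL(2, ℝ)} {lam : ℝ}

/-- `x = (λXY) ∘ M⁻¹` when `x ∘ M = λXY`. [folklore] -/
theorem eq_actSL_inv (hM : actSL M x = xyForm lam) : x = actSL M⁻¹ (xyForm lam) := by
  rw [← hM, actSL_mul, mul_inv_cancel, actSL_one]

/-- **Stabilising `x` means being diagonal after conjugation by `M`.** [folklore] -/
theorem actSL_eq_iff_conj (hlam : lam ≠ 0) (hM : actSL M x = xyForm lam) (g : SL(2, ℝ)) :
    actSL g x = x ↔ ((M⁻¹ * g * M) 1 0 : ℝ) = 0 ∧ ((M⁻¹ * g * M) 0 1 : ℝ) = 0 := by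
  rw [← actSL_xyForm_eq_iff hlam]
  constructor
  · intro h
    calc actSL (M⁻¹ * g * M) (xyForm lam) = actSL (M⁻¹ * g * M) (actSL M x) := by rw [hM]
      _ = actSL (M * (M⁻¹ * g * M)) x := actSL_mul _ _ _
      _ = actSL (g * M) x := by congr 1; group
      _ = actSL M (actSL g x) := (actSL_mul _ _ _).symm
      _ = xyForm lam := by rw [h, hM]
  · intro h
    have hx := eq_actSL_inv hM
    calc actSL g x = actSL g (actSL M⁻¹ (xyForm lam)) := by rw [← hx]
      _ = actSL (M⁻¹ * g) (xyForm lam) := actSL_mul _ _ _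
      _ = actSL ((M⁻¹ * g * M) * M⁻¹) (xyForm lam) := by congr 1; group
      _ = actSL M⁻¹ (actSL (M⁻¹ * g * M) (xyForm lam)) := (actSL_mul _ _ _).symm
      _ = actSL M⁻¹ (xyForm lam) := by rw [h]
      _ = x := hx.symm

/-- The diagonal entries of the conjugate of a stabilising element multiply to `1`. [folklore] -/
theorem conj_diag_mul (hlam : lam ≠ 0) (hM : actSL M x = xyForm lam) {g : SL(2, ℝ)} (hg : actSL g x = x) :
    ((M⁻¹ * g * M) 0 0 : ℝ) * (M⁻¹ * g * M) 1 1 = 1 := by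
  obtain ⟨hc, hb⟩ := (actSL_eq_iff_conj hlam hM g).mp hg
  have := det_entries_real (M⁻¹ * g * M)
  rw [hc, hb, mul_zero, sub_zero] at this
  exact this

/-- **The multiplier** `κ(g) = u²`, `M⁻¹ g M = diag(u, u⁻¹)`. [folklore] -/
def multK (M g : SL(2, ℝ)) : ℝ := ((M⁻¹ * g * M) 0 0 : ℝ) ^ 2

/-- `κ(g) > 0` for stabilising `g`. [folklore] -/
theorem multK_pos (hlam : lam ≠ 0) (hM : actSL M x = xyForm lam) {g : SL(2, ℝ)} (hg : actSL g x = x) :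
    0 < multK M g := by
  have h := conj_diag_mul hlam hM hg
  have h0 : ((M⁻¹ * g * M) 0 0 : ℝ) ≠ 0 := by
    intro h0; rw [h0, zero_mul] at h; exact zero_ne_one h
  exact pow_pos (abs_pos.mpr h0) 2 |>.trans_eq (sq_abs _)

/-- **Multiplicativity**: `κ(gh) = κ(g) κ(h)` on the stabiliser. [folklore] -/
theorem multK_mul (hlam : lam ≠ 0) (hM : actSL M x = xyForm lam) {g h : SL(2, ℝ)}
    (hg : actSL g x = x) (hh : actSL h x = x) : multK M (g * h) = multK M g * multK M h := by
  obtain ⟨hgc, hgb⟩ := (actSL_eq_iff_conj hlam hM g).mp hg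
  obtain ⟨hhc, hhb⟩ := (actSL_eq_iff_conj hlam hM h).mp hh
  unfold multK
  have hprod : M⁻¹ * (g * h) * M = (M⁻¹ * g * M) * (M⁻¹ * h * M) := by group
  rw [hprod]
  have e00 : (((M⁻¹ * g * M) * (M⁻¹ * h * M)) 0 0 : ℝ) =
      (M⁻¹ * g * M) 0 0 * (M⁻¹ * h * M) 0 0 + (M⁻¹ * g * M) 0 1 * (M⁻¹ * h * M) 1 0 := by
    simp [Matrix.mul_apply, Fin.sum_univ_two]
  rw [e00, hgb, zero_mul, add_zero, mul_pow]

/-- **The conjugated action is a homothety**: `M⁻¹(g w) = κ(g) · M⁻¹ w` for stabilising `g`. [folklore] -/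
theorem coe_inv_smul_smul (hlam : lam ≠ 0) (hM : actSL M x = xyForm lam) {g : SL(2, ℝ)}
    (hg : actSL g x = x) (w : ℍ) :
    (((M⁻¹ • (g • w) : ℍ)) : ℂ) = (multK M g : ℂ) * (((M⁻¹ • w : ℍ)) : ℂ) := by
  obtain ⟨hc, hb⟩ := (actSL_eq_iff_conj hlam hM g).mp hg
  have hdiag := conj_diag_mul hlam hM hg
  have h1 : M⁻¹ • (g • w) = (M⁻¹ * g * M) • (M⁻¹ • w) := by
    rw [← mul_smul, ← mul_smul]; congr 1; group
  rw [h1, UpperHalfPlane.coe_specialLinearGroup_apply]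
  have e : ∀ r : ℝ, algebraMap ℝ ℝ r = r := fun r ↦ rfl
  simp only [e]
  rw [hc, hb]
  push_cast
  rw [zero_mul, zero_add, add_zero, multK]
  have hd : ((M⁻¹ * g * M) 1 1 : ℝ) = ((M⁻¹ * g * M) 0 0 : ℝ)⁻¹ := by
    have h0 : ((M⁻¹ * g * M) 0 0 : ℝ) ≠ 0 := by
      intro h0; rw [h0, zero_mul] at hdiag; exact zero_ne_one hdiag
    field_simp; linarith
  rw [hd]
  have h0 : (((M⁻¹ * g * M) 0 0 : ℝ) : ℂ) ≠ 0 := by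
    intro h0
    have : ((M⁻¹ * g * M) 0 0 : ℝ) = 0 := by exact_mod_cast h0
    rw [this, zero_mul] at hdiag; exact zero_ne_one hdiag
  push_cast
  field_simp

/-- `κ(g) = 1` forces `g = ±1`. [folklore] -/
theorem eq_one_or_neg_one_of_multK_eq_one (hlam : lam ≠ 0) (hM : actSL M x = xyForm lam) {g : SL(2, ℝ)}
    (hg : actSL g x = x) (hk : multK M g = 1) : g = 1 ∨ g = -1 := by
  obtain ⟨hc, hb⟩ := (actSL_eq_iff_conj hlam hM g).mp hg
  have hdiag := conj_diag_mul hlam hM hg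
  set δ := M⁻¹ * g * M with hδ
  have hu : (δ 0 0 : ℝ) = 1 ∨ (δ 0 0 : ℝ) = -1 := by
    have : ((δ 0 0 : ℝ) - 1) * ((δ 0 0 : ℝ) + 1) = 0 := by
      unfold multK at hk; ring_nf; linarith [hk]
    rcases mul_eq_zero.mp this with h | h
    · left; linarith
    · right; linarith
  have hg' : g = M * δ * M⁻¹ := by rw [hδ]; group
  rcases hu with hu | hu
  · left
    have hd : (δ 1 1 : ℝ) = 1 := by rw [hu, one_mul] at hdiag; exact hdiag
    have : δ = 1 := by
      ext i j; fin_cases i <;> fin_cases j <;> simp [hu, hb, hc, hd]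
    rw [hg', this, mul_one, mul_inv_cancel]
  · right
    have hd : (δ 1 1 : ℝ) = -1 := by rw [hu] at hdiag; linarith
    have : δ = -1 := by
      ext i j
      fin_cases i <;> fin_cases j <;>
        simp [Matrix.SpecialLinearGroup.coe_neg, hu, hb, hc, hd]
    rw [hg', this]
    simp

end Conj

end Literature.NumberTheory.EllipticCurves.Shintani
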